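import Mathlib
import Literature.RepresentationTheory.FiniteGroups.KLRGradedCellularBasis
import Summits.MatrixMultiplication.MatrixMultiplication.Theorems.SnSubsetDichotomyNoThresholdSubsetTripleSmallWeightTail
import Summits.MatrixMultiplication.MatrixMultiplication.Theorems.SnSubsetDichotomyNoThresholdSubsetTripleStubTransposeDegree

/-!
# `SnSubsetDichotomy.NoThresholdSubsetTriple`, line `klr-graded-polynomial-method`:
# stubs `sum_degree_sub_weight_eq_zero` and `card_degree_sub_weight_symm`
# (exact centering and palindromicity of the pair degree in every `2`-block)

For a same-shape pair of standard tableaux `i = (μ, S, T) : TableauPair n` let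
`X i = TableauPair.degree 2 i = deg₂ S + deg₂ T` be its Brundan–Kleshchev–Wang pair degree,
`cⱼ = TableauPair.content 2 i j = residueContent 2 μ j` its `2`-content and
`w i = c₀ − (c₀ − c₁)²` the weight ("defect") of its `2`-block. With the centred degree
`Y i = X i − w i`:

* `sum_degree_sub_weight_eq_zero`: `∑_{content i = α} Y i = 0` for every content `α`
  (exact CENTERING of the pair degree in each block);
* `card_degree_sub_weight_symm`: `#{content i = α ∧ Y i = d} = #{content i = α ∧ Y i = −d}`
  (PALINDROMICITY of the block graded dimension `∑_{content i = α} q^{X i}` about `q^{w}`).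

Both are the combinatorial shadow of the graded symmetry of the blocks of `𝔽₂S_n`, proved here
from ONE mechanism, the transpose map `τ : (μ, S, T) ↦ (μᵗ, Sᵗ, Tᵗ)` of the tree
(`KlrLine.exists_transposePair`): it is injective on the finite type `TableauPair n`, hence a
bijection; it preserves the `2`-content (`KlrLine.residueContent_transpose`), hence `w`; and
`deg₂ T + deg₂ Tᵗ = w` (`stub_transposeDegree`) gives `X (τ i) = 2 w i − X i`, i.e.
`Y (τ i) = −Y i`. Reindexing the block sum along `τ` gives `s = −s`, and `τ` restricts to a
bijection `{content = α, Y = d} ≃ {content = α, Y = −d}`.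
-/

namespace Summit.MatrixMultiplication.MatrixMultiplication.Theorems

open Literature.RepresentationTheory.FiniteGroups (TableauPair KLRGradedCellularBasis residueContent tableauDegree)
open Literature.NumberTheory.DiophantineGeometry (StdFilling)

namespace KlrLine

set_option linter.dupNamespace false in -- deliberate Summit.<S>.<P> duplicate
/-- **The transpose bijection negates the centred pair degree.** There is a bijection `e` of
`TableauPair n` (the transpose map `(μ, S, T) ↦ (μᵗ, Sᵗ, Tᵗ)`, bijective as an injective
self-map of a finite type) preserving the `2`-content and with
`deg₂ (e i) + deg₂ i = 2·(c₀ − (c₀ − c₁)²)`, `cⱼ = TableauPair.content 2 i j`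
(from `stub_transposeDegree` applied to both tableaux of the pair). [folklore] -/
theorem exists_transposeEquiv (n : ℕ) :
    ∃ e : TableauPair n ≃ TableauPair n, ∀ i,
      TableauPair.content 2 (e i) = TableauPair.content 2 i ∧
        TableauPair.degree 2 (e i) + TableauPair.degree 2 i =
          2 * ((TableauPair.content 2 i 0 : ℤ) -
            ((TableauPair.content 2 i 0 : ℤ) - (TableauPair.content 2 i 1 : ℤ)) ^ 2) := by
  obtain ⟨τ, hτ, hτ'⟩ := exists_transposePair n
  refine ⟨Equiv.ofBijective τ hτ.bijective_of_finite, fun i => ?_⟩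
  obtain ⟨h1, h2, h3⟩ := hτ' i
  rw [Equiv.ofBijective_apply]
  refine ⟨funext fun j => ?_, ?_⟩
  · unfold TableauPair.content
    rw [h1]
    exact residueContent_transpose n i.1 j
  · unfold TableauPair.degree TableauPair.content
    rw [h2, h3]
    have hS := stub_transposeDegree n i.1 i.2.1
    have hT := stub_transposeDegree n i.1 i.2.2
    linear_combination hS + hT

set_option linter.dupNamespace false in -- deliberate Summit.<S>.<P> duplicate
/-- **The transpose bijection on the centred degree**: with `Y i = deg₂ i − w i`,
`w i = c₀ − (c₀ − c₁)²`, there is a content-preserving bijection `e` of `TableauPair n` with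
`Y (e i) = −Y i`. [folklore] -/
theorem exists_equiv_degree_sub_weight_neg (n : ℕ) :
    ∃ e : TableauPair n ≃ TableauPair n, ∀ i,
      TableauPair.content 2 (e i) = TableauPair.content 2 i ∧
        TableauPair.degree 2 (e i) - ((TableauPair.content 2 (e i) 0 : ℤ) -
            ((TableauPair.content 2 (e i) 0 : ℤ) - (TableauPair.content 2 (e i) 1 : ℤ)) ^ 2) =
          -(TableauPair.degree 2 i - ((TableauPair.content 2 i 0 : ℤ) -
            ((TableauPair.content 2 i 0 : ℤ) - (TableauPair.content 2 i 1 : ℤ)) ^ 2)) := by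
  obtain ⟨e, he⟩ := exists_transposeEquiv n
  refine ⟨e, fun i => ⟨(he i).1, ?_⟩⟩
  rw [(he i).1]
  linear_combination (he i).2

end KlrLine

set_option linter.dupNamespace false in -- deliberate Summit.<S>.<P> duplicate
/-- **Stub `sum_degree_sub_weight_eq_zero` (line `klr-graded-polynomial-method`, crux
`SnSubsetDichotomy.NoThresholdSubsetTriple`, stmt-MatrixMultiplication-8302): exact centering of
the pair degree in every `2`-block.** For every `n` and every `2`-content `α`, the centred
Brundan–Kleshchev–Wang pair degrees `Y i = deg₂ S + deg₂ T − w(μ)`,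
`w(μ) = c₀ − (c₀ − c₁)²` the block weight, of the same-shape pairs `i = (μ, S, T)` of content
`α` sum to zero: `∑_{content i = α} Y i = 0`. Proof: reindex along the content-preserving
transpose bijection `e` with `Y (e i) = −Y i` (`KlrLine.exists_equiv_degree_sub_weight_neg`):
the sum `s` equals `−s`. [folklore] -/
theorem sum_degree_sub_weight_eq_zero : ∀ (n : ℕ) (α : ZMod 2 → ℕ), ∑ i ∈ (Finset.univ : Finset (TableauPair n)).filter (fun i => TableauPair.content 2 i = α), (TableauPair.degree 2 i - ((TableauPair.content 2 i 0 : ℤ) - ((TableauPair.content 2 i 0 : ℤ) - (TableauPair.content 2 i 1 : ℤ)) ^ 2)) = 0 := by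
  intro n α
  obtain ⟨e, he⟩ := KlrLine.exists_equiv_degree_sub_weight_neg n
  have hs : ∑ i ∈ (Finset.univ : Finset (TableauPair n)).filter
        (fun i => TableauPair.content 2 i = α),
      (TableauPair.degree 2 i - ((TableauPair.content 2 i 0 : ℤ) -
        ((TableauPair.content 2 i 0 : ℤ) - (TableauPair.content 2 i 1 : ℤ)) ^ 2)) =
      ∑ i ∈ (Finset.univ : Finset (TableauPair n)).filter
        (fun i => TableauPair.content 2 i = α),
      -(TableauPair.degree 2 i - ((TableauPair.content 2 i 0 : ℤ) -
        ((TableauPair.content 2 i 0 : ℤ) - (TableauPair.content 2 i 1 : ℤ)) ^ 2)) := by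
    refine Finset.sum_equiv e (fun i => ?_) (fun i _ => ?_)
    · simp only [Finset.mem_filter, Finset.mem_univ, true_and, (he i).1]
    · rw [(he i).2, neg_neg]
  rw [Finset.sum_neg_distrib] at hs
  linarith

set_option linter.dupNamespace false in -- deliberate Summit.<S>.<P> duplicate
/-- **Stub `card_degree_sub_weight_symm` (line `klr-graded-polynomial-method`, crux
`SnSubsetDichotomy.NoThresholdSubsetTriple`, stmt-MatrixMultiplication-8302): palindromicity of
the pair degree in every `2`-block.** For every `n`, every `2`-content `α` and every `d : ℤ`,
the same-shape pairs `i = (μ, S, T)` of content `α` with centred pair degree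
`Y i = deg₂ S + deg₂ T − w(μ) = d` are as many as those with `Y i = −d` (the block graded
dimension `∑_{content i = α} q^{deg₂ S + deg₂ T}` of `𝔽₂S_n` is a palindrome centred at
`q^{w}`). Proof: the content-preserving transpose bijection `e` with `Y (e i) = −Y i`
(`KlrLine.exists_equiv_degree_sub_weight_neg`) restricts to a bijection of the two subtypes.
[folklore] -/
theorem card_degree_sub_weight_symm : ∀ (n : ℕ) (α : ZMod 2 → ℕ) (d : ℤ), Nat.card {i : TableauPair n // TableauPair.content 2 i = α ∧ TableauPair.degree 2 i - ((TableauPair.content 2 i 0 : ℤ) - ((TableauPair.content 2 i 0 : ℤ) - (TableauPair.content 2 i 1 : ℤ)) ^ 2) = d} = Nat.card {i : TableauPair n // TableauPair.content 2 i = α ∧ TableauPair.degree 2 i - ((TableauPair.content 2 i 0 : ℤ) - ((TableauPair.content 2 i 0 : ℤ) - (TableauPair.content 2 i 1 : ℤ)) ^ 2) = -d} := by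
  intro n α d
  obtain ⟨e, he⟩ := KlrLine.exists_equiv_degree_sub_weight_neg n
  refine Nat.card_congr (e.subtypeEquiv fun i => ?_)
  rw [(he i).2, (he i).1, neg_inj]

end Summit.MatrixMultiplication.MatrixMultiplication.Theorems
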